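import Summits.BirchSwinnertonDyer.BirchSwinnertonDyer.Theorems.ManinLocalTwoThreeNewformForty
import HarnessLib

/-!
# Uniqueness of `q`-asymptotic expansions: the first `m + 1` Fourier coefficients of a cusp form from `S = P(q) + o(q^m)`

Cell bsd-f2-manin, route `ManinLocalTwoThree` (cruxes C2 stmt-22967 / C3 stmt-22968), prover seat p2 gen 27.  General form of the two- and
three-coefficient extraction lemmas `NewformForty.cuspCoeff_eq_of_tendsto_sq`, `NewformSeventyTwo.cuspCoeff_eq_of_tendsto_cube` used by the
fact-free newform pinnings at `40` and `72`:

* `poly_eq_zero_of_tendsto_div_pow`: a polynomial `R ∈ ℂ[X]` of degree `≤ m` with `R(q(τ))/q(τ)^m → 0` at `i∞` is `0` (induction on `m`: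
  the constant coefficient is the limit of `R(q)`, then divide by `X`).
* `cuspCoeff_eq_coeff_of_tendsto`: if `S ∈ S₂(Γ₀(N))` and `P ∈ ℂ[X]` has degree `≤ m` with `(S − P(q))/q^m → 0` at `i∞`, then
  `aₙ(S) = P.coeff n` for all `n ≤ m` (the `q`-expansion of `S` sums to `S`, so its truncation is another such `P`; uniqueness).

This is the coefficient-matrix tool for linear (in)dependence of explicit old forms (sequel: `…NoNewformSixty`).  No definition, no named
fact, no sorry; nothing here proves C2, C3, Manin's conjecture or BSD. [cite: DiamondShurman2005, §1.1]
-/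

set_option autoImplicit false
-- lint-debt: the directory name repeats the summit name (sibling precedent `ManinLocalTwoThreeNewformForty.lean`)
set_option linter.dupNamespace false

noncomputable section

open Complex Filter Topology Set Function Asymptotics Polynomial
open UpperHalfPlane hiding I
open scoped Real Topology Manifold MatrixGroups ModularForm
open ModularForm CongruenceSubgroup
open Literature.NumberTheory.EllipticCurves Literature.NumberTheory.EllipticCurves.ModularForms

namespace Summit.BirchSwinnertonDyer.BirchSwinnertonDyer.Theorems.ManinLocalTwoThree.CuspCoeffAsymptotics

open QRemainder

/-- **A polynomial of degree `≤ m` which is `o(q^m)` at `i∞` vanishes.** [folklore] -/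
theorem poly_eq_zero_of_tendsto_div_pow (m : ℕ) : ∀ (R : ℂ[X]), R.natDegree ≤ m →
    Tendsto (fun τ : ℍ ↦ R.eval (Function.Periodic.qParam 1 (τ : ℂ)) / Function.Periodic.qParam 1 (τ : ℂ) ^ m) atImInfty (𝓝 0) →
    R = 0 := by
  induction m with
  | zero =>
    intro R hR h
    rw [Polynomial.eq_C_of_natDegree_le_zero hR] at h ⊢
    simp only [eval_C, pow_zero, div_one, tendsto_const_nhds_iff] at h
    rw [h, map_zero]
  | succ m ih =>
    intro R hR h
    -- the constant coefficient vanishes: `R(q) → R(0)` and `R(q) = (R(q)/q^{m+1}) q^{m+1} → 0`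
    have hq := QRemainder.tendsto_qParam
    have h0 : R.coeff 0 = 0 := by
      have hA := h.mul (hq.pow (m + 1))
      rw [zero_mul] at hA
      have hA' : Tendsto (fun τ : ℍ ↦ R.eval (Function.Periodic.qParam 1 (τ : ℂ))) atImInfty (𝓝 0) := by
        refine hA.congr fun τ ↦ ?_
        exact div_mul_cancel₀ _ (pow_ne_zero _ (qParam_ne_zero τ))
      have hB := tendsto_eval_qParam R
      rw [← Polynomial.coeff_zero_eq_eval_zero] at hB
      exact tendsto_nhds_unique hB hA'
    -- `R = X · R₁` with `deg R₁ ≤ m` and `R₁(q)/q^m = R(q)/q^{m+1} → 0`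
    obtain ⟨R₁, hR₁⟩ := Polynomial.X_dvd_iff.mpr h0
    have hR₁deg : R₁.natDegree ≤ m := by
      by_cases hz : R₁ = 0
      · rw [hz, natDegree_zero]; exact Nat.zero_le _
      · have := Polynomial.natDegree_X_mul hz
        rw [← hR₁] at this
        omega
    have h1 : Tendsto (fun τ : ℍ ↦ R₁.eval (Function.Periodic.qParam 1 (τ : ℂ)) / Function.Periodic.qParam 1 (τ : ℂ) ^ m)
        atImInfty (𝓝 0) := by
      refine h.congr fun τ ↦ ?_
      have hqτ := qParam_ne_zero τ
      rw [hR₁, eval_mul, eval_X, pow_succ]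
      field_simp
    rw [hR₁, ih R₁ hR₁deg h1, mul_zero]

/-- **Coefficient extraction from a `q`-asymptotic expansion**: if `S ∈ S₂(Γ₀(N))`, `deg P ≤ m` and `S = P(q) + o(q^m)` at `i∞`, then
`aₙ(S) = P.coeff n` for every `n ≤ m`. [cite: DiamondShurman2005, §1.1] -/
theorem cuspCoeff_eq_coeff_of_tendsto {N : ℕ} (S : CuspForm (Gamma0 N) 2) (P : ℂ[X]) (m : ℕ) (hP : P.natDegree ≤ m)
    (h : Tendsto (fun τ : ℍ ↦ (S τ - P.eval (Function.Periodic.qParam 1 (τ : ℂ))) / Function.Periodic.qParam 1 (τ : ℂ) ^ m) atImInfty (𝓝 0))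
    (n : ℕ) (hn : n ≤ m) : cuspCoeff S n = P.coeff n := by
  have hΓ := one_mem_strictPeriods_coe_gamma0 N
  have hper : Function.Periodic (⇑S ∘ ofComplex) 1 := SlashInvariantFormClass.periodic_comp_ofComplex S hΓ
  have hmd : MDifferentiable 𝓘(ℂ) 𝓘(ℂ) ⇑S := CuspFormClass.holo S
  haveI : Fact (IsCusp OnePoint.infty ((Gamma0 N : Subgroup SL(2, ℤ)) : Subgroup (GL (Fin 2) ℝ))) :=
    ⟨Subgroup.isCusp_of_mem_strictPeriods one_pos hΓ⟩
  have hbd : IsBoundedAtImInfty ⇑S := ModularFormClass.bdd_at_infty S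
  have hsum : ∀ τ : ℍ, HasSum (fun k : ℕ ↦ cuspCoeff S k • Function.Periodic.qParam 1 (τ : ℂ) ^ k) (S τ) :=
    fun τ ↦ hasSum_qExpansion one_pos hper hmd hbd τ
  set Q : ℂ[X] := ∑ k ∈ Finset.range (m + 1), C (cuspCoeff S k) * X ^ k with hQ
  have hQm := tendsto_of_hasSum hper hmd hbd hsum m
  -- `D = Q − P` is `o(q^m)` of degree `≤ m`, hence `0`
  have hD : Tendsto (fun τ : ℍ ↦ (Q - P).eval (Function.Periodic.qParam 1 (τ : ℂ)) / Function.Periodic.qParam 1 (τ : ℂ) ^ m)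
      atImInfty (𝓝 0) := by
    have := h.sub hQm
    rw [sub_zero] at this
    refine this.congr fun τ ↦ ?_
    rw [eval_sub]
    ring
  have hQdeg : Q.natDegree ≤ m := by
    refine Polynomial.natDegree_sum_le_of_forall_le _ _ fun k hk ↦ ?_
    exact (Polynomial.natDegree_C_mul_X_pow_le _ _).trans (Nat.lt_succ_iff.mp (Finset.mem_range.mp hk))
  have hdeg : (Q - P).natDegree ≤ m := (Polynomial.natDegree_sub_le Q P).trans (max_le hQdeg hP)
  have hQP : Q = P := sub_eq_zero.mp (poly_eq_zero_of_tendsto_div_pow m (Q - P) hdeg hD)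
  rw [← hQP, hQ, Polynomial.finsetSum_coeff]
  simp only [Polynomial.coeff_C_mul_X_pow]
  rw [Finset.sum_eq_single n (fun k _ hk ↦ if_neg (Ne.symm hk)) (fun hn' ↦ absurd (Finset.mem_range.mpr (Nat.lt_succ_of_le hn)) hn'),
    if_pos rfl]

end Summit.BirchSwinnertonDyer.BirchSwinnertonDyer.Theorems.ManinLocalTwoThree.CuspCoeffAsymptotics

end
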